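import Literature.Geometry.Kaehler.ComplexTorusSubvarieties
import Mathlib.LinearAlgebra.SesquilinearForm.Basic
import HarnessLib

/-!
# The integral alternating form of a Riemann form on the lattice of a complex torus

For a complex torus `X = E/Φ(ℤ^ι)` (`ComplexTorus Φ`, `Φ : ℝ^ι ≃ E` a period isomorphism,
`Literature/Geometry/Kaehler/ComplexTorus.lean`) with a Riemann form `η`
(`ComplexTorus.IsRiemannForm Φ η`, `ComplexTorusSubvarieties.lean`: `η(iu, iv) = η(u, v)`,
`η(Φ m, Φ n) ∈ ℤ` for lattice vectors, `η(iu, u) > 0` for `u ≠ 0`), the restriction of `η` to the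
lattice `Λ = ℤ^ι` is an **integer-valued alternating nondegenerate bilinear form**
`E_Λ : Λ × Λ → ℤ` (Lange–Birkenhake, *Complex Abelian Varieties*, §2.1 (Prop. 2.1.6:
`E = Im H` is integer valued on `Λ`) and §3.1 (a polarization is a NONDEGENERATE alternating form
on `Λ`; its elementary divisors `d₁ | ⋯ | d_g` are the type)). This is the input of Frobenius'
elementary-divisor theorem (symplectic basis of type `D`), whose output feeds the Siegel normal
form `ComplexTorusSiegelNormalForm.lean`.

* `ComplexTorus.IsRiemannForm.exists_intForm` — `∃ B : LinearMap.BilinForm ℤ (ι → ℤ)` with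
  `(B m n : ℝ) = η(Φ m, Φ n)`, `B` alternating (`B.IsAlt`) and nondegenerate (`B.Nondegenerate`:
  `B(m, ·) = 0 ⇒ m = 0` and `B(·, n) = 0 ⇒ n = 0`). Nondegeneracy: if `η(Φ m, Φ n) = 0` for all
  lattice vectors `n` then, `ℤ^ι` spanning `ℝ^ι`, `η(Φ m, u) = 0` for all `u ∈ E`, and
  `u = iΦ m` gives `η(iΦm, Φm) = 0`, so `Φ m = 0` by positivity.

Everything here is a theorem; no definition, no named fact.

## References

* [LangeBirkenhake1992] H. Lange, Ch. Birkenhake, *Complex Abelian Varieties*, Grundlehren 302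
  (1992), §2.1 Prop. 2.1.6, Lemma 2.1.7; §3.1 (type of a polarization).
-/

noncomputable section

namespace Literature.Geometry.Kaehler

namespace ComplexTorus

variable {ι : Type*} [Fintype ι] {E : Type*} [NormedAddCommGroup E] [NormedSpace ℂ E]

/-- Antisymmetry of a real `2`-form: `η(x, y) = -η(y, x)`. [folklore] -/
private theorem twoForm_swap' (η : E [⋀^Fin 2]→L[ℝ] ℝ) (x y : E) : η ![x, y] = -η ![y, x] := by
  have h := η.toAlternatingMap.map_swap ![y, x] (show (0 : Fin 2) ≠ 1 by decide)
  have e : (![y, x] ∘ Equiv.swap (0 : Fin 2) 1) = ![x, y] := by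
    funext i; fin_cases i <;> rfl
  rw [e] at h
  exact h

omit [Fintype ι] in
/-- The real bilinear form `(x, y) ↦ η(Φ x, Φ y)` on the lattice space `ℝ^ι`. [folklore] -/
private theorem exists_bilinForm_comp (Φ : (ι → ℝ) ≃L[ℝ] E) (η : E [⋀^Fin 2]→L[ℝ] ℝ) :
    ∃ B : LinearMap.BilinForm ℝ (ι → ℝ), ∀ x y, B x y = η ![Φ x, Φ y] := by
  refine ⟨LinearMap.mk₂ ℝ (fun x y => η ![Φ x, Φ y]) (fun x x' y => ?_) (fun r x y => ?_)
    (fun x y y' => ?_) (fun r x y => ?_), fun x y => rfl⟩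
  · change η ![Φ (x + x'), Φ y] = η ![Φ x, Φ y] + η ![Φ x', Φ y]
    rw [map_add]
    exact η.vecCons_add ![Φ y] (Φ x) (Φ x')
  · change η ![Φ (r • x), Φ y] = r • η ![Φ x, Φ y]
    rw [map_smul]
    exact η.vecCons_smul ![Φ y] r (Φ x)
  · change η ![Φ x, Φ (y + y')] = η ![Φ x, Φ y] + η ![Φ x, Φ y']
    rw [map_add, twoForm_swap' η (Φ x) (Φ y + Φ y'), twoForm_swap' η (Φ x) (Φ y),
      twoForm_swap' η (Φ x) (Φ y'), η.vecCons_add ![Φ x] (Φ y) (Φ y'), neg_add]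
  · change η ![Φ x, Φ (r • y)] = r • η ![Φ x, Φ y]
    rw [map_smul, twoForm_swap' η (Φ x) (r • Φ y), twoForm_swap' η (Φ x) (Φ y),
      η.vecCons_smul ![Φ x] r (Φ y), smul_neg]

omit [Fintype ι] in
/-- `intVec` is additive. [folklore] -/
private theorem intVec_add (m n : ι → ℤ) : intVec (m + n) = intVec m + intVec n := by
  funext i; simp [intVec]

omit [Fintype ι] in
/-- `intVec` commutes with integer scalars. [folklore] -/
private theorem intVec_zsmul (c : ℤ) (m : ι → ℤ) : intVec (c • m) = (c : ℝ) • intVec m := by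
  funext i; simp [intVec]

omit [Fintype ι] in
/-- `intVec` is injective. [folklore] -/
private theorem intVec_injective : Function.Injective (intVec (ι := ι)) := fun m n h =>
  funext fun i => by
    have := congrFun h i
    simpa [intVec] using this

omit [Fintype ι] in
/-- The standard basis vectors of `ℝ^ι` are lattice vectors. [folklore] -/
private theorem intVec_single [DecidableEq ι] (i : ι) :
    intVec (Pi.single i (1 : ℤ) : ι → ℤ) = Pi.single i (1 : ℝ) := by
  funext j
  by_cases h : j = i
  · subst h; simp [intVec]
  · simp [intVec, Pi.single_eq_of_ne h]

/-- **The integral alternating form of a Riemann form.** For a Riemann form `η` of the complex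
torus `E/Φ(ℤ^ι)` there is an integer-valued bilinear form `B` on the lattice `ℤ^ι` with
`B(m, n) = η(Φ m, Φ n)`, which is alternating and nondegenerate (Lange–Birkenhake, Prop. 2.1.6:
`E = Im H` is integer valued on `Λ`; §3.1: the alternating form of a polarization is
nondegenerate, with elementary divisors the type `(d₁, …, d_g)`). Nondegeneracy comes from
`η(iu, u) > 0`: a lattice vector pairing to zero with the lattice pairs to zero with `E = Λ ⊗ ℝ`,
in particular with `i` times itself. [cite: LangeBirkenhake1992, §2.1 Prop. 2.1.6 and §3.1] -/
theorem IsRiemannForm.exists_intForm (Φ : (ι → ℝ) ≃L[ℝ] E) {η : E [⋀^Fin 2]→L[ℝ] ℝ}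
    (hη : IsRiemannForm Φ η) :
    ∃ B : LinearMap.BilinForm ℤ (ι → ℤ),
      (∀ m n, (B m n : ℝ) = η ![Φ (intVec m), Φ (intVec n)]) ∧ B.IsAlt ∧ B.Nondegenerate := by
  classical
  obtain ⟨Br, hBr⟩ := exists_bilinForm_comp Φ η
  -- the integer values
  choose k hk using hη.2.1
  have hkBr : ∀ m n, (k m n : ℝ) = Br (intVec m) (intVec n) := fun m n => by rw [hBr, hk]
  -- `ℤ`-bilinearity, read off in `ℝ`
  have hcast : ∀ {a c : ℤ}, (a : ℝ) = (c : ℝ) → a = c := fun h => by exact_mod_cast h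
  refine ⟨LinearMap.mk₂ ℤ k (fun m m' n => ?_) (fun c m n => ?_) (fun m n n' => ?_)
    (fun c m n => ?_), fun m n => (hk m n).symm, fun m => ?_, ?_⟩
  · apply hcast; push_cast
    rw [hkBr, hkBr, hkBr, intVec_add, map_add, LinearMap.add_apply]
  · rw [smul_eq_mul]; apply hcast; push_cast
    rw [hkBr, hkBr, intVec_zsmul, map_smul, LinearMap.smul_apply, smul_eq_mul]
  · apply hcast; push_cast
    rw [hkBr, hkBr, hkBr, intVec_add, map_add]
  · rw [smul_eq_mul]; apply hcast; push_cast
    rw [hkBr, hkBr, intVec_zsmul, map_smul, smul_eq_mul]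
  · -- alternating
    change k m m = 0
    apply hcast; push_cast
    rw [← hk]
    exact η.map_eq_zero_of_eq ![Φ (intVec m), Φ (intVec m)] (i := 0) (j := 1) rfl (by decide)
  · -- nondegenerate: left-separating, and right-separating by antisymmetry
    have hleft : ∀ m : ι → ℤ, (∀ n, k m n = 0) → m = 0 := by
      intro m hm
      -- `η(Φ m, Φ x) = 0` for every `x ∈ ℝ^ι`: the functional `Br (intVec m)` kills the basis
      have hzero : Br (intVec m) = 0 := by
        refine (Pi.basisFun ℝ ι).ext fun i => ?_
        rw [Pi.basisFun_apply, LinearMap.zero_apply, ← intVec_single, ← hkBr, hm, Int.cast_zero]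
      have hu : η ![Complex.I • Φ (intVec m), Φ (intVec m)] = 0 := by
        have h1 : η ![Φ (intVec m), Complex.I • Φ (intVec m)] = 0 := by
          have := congrArg (fun f : (ι → ℝ) →ₗ[ℝ] ℝ => f (Φ.symm (Complex.I • Φ (intVec m)))) hzero
          simp only [LinearMap.zero_apply, hBr, ContinuousLinearEquiv.apply_symm_apply] at this
          exact this
        rw [twoForm_swap', h1, neg_zero]
      have hΦm : Φ (intVec m) = 0 := hη.eq_zero_of_apply_eq_zero hu
      have him : intVec m = 0 := Φ.injective (by rw [hΦm, map_zero])
      exact intVec_injective (by rw [him]; funext i; simp [intVec])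
    refine ⟨fun m hm => hleft m fun n => hm n, fun n hn => hleft n fun m => ?_⟩
    -- `k n m = -k m n = 0`
    have h := hn m
    change k m n = 0 at h
    apply hcast; push_cast
    rw [← hk, twoForm_swap', hk m n, h, Int.cast_zero, neg_zero]

end ComplexTorus

end Literature.Geometry.Kaehler

end
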